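import Literature.NumberTheory.EllipticCurves.CongruenceNumber
import Literature.NumberTheory.DiophantineGeometry.Conductor
import HarnessLib
import HarnessLib.Audit.Tags

/-!
# Candidate E-desc-2 of cell `bsd-f2-manin` (D-0131 (3) frontier: the Manin constant at additive
# primes): «one budget `⌊ord_p(N)/2⌋` pays for BOTH the Manin defect and the congruence defect of
# the optimal curve» — a conjectural LAW. A `@[conjecture]` leaf (NOTHING asserted; definition
# only; proved placement edges in the sibling `ManinCongruenceDefectLawEdges.lean`).

HONEST FRAMING. LENS = descent / visibility (planner `bsd-f2-manin-desc`, HOME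
`run/shared/lean/pub/bsd-f2-manin/MEMO-desc.md` §3, Sketch.lean sha16 a03e6549cfc5163d). Informal
law: «for the `X₀(N)`-optimal curve `E` and every prime `p`:
`ord_p(c_E) + ord_p(r_E/m_E) ≤ ⌊ord_p(N)/2⌋`», `r_E` the congruence number, `m_E` the modular
degree. It is Agashe–Ribet–Stein 2012 Conj. 2.2 (tree `@[conjecture]`
`Literature.NumberTheory.EllipticCurves.ModularForms.AgasheRibetStein2012_conjecture`:
`ord_p(r_E/m_E) ≤ ½ ord_p(N)`, OPEN, checked by ARS for `N ≤ 557`) with the Manin defect ADDED on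
the left, suggested by the lens identity (††) `ord_p(c_E) = t_p − a_p − ord_p(r_E/m_E)` of the
memo (§1; a VARIANT of Česnavičius 2016 §2 at square primes — the memo's own bookkeeping, not
print). NOT in print: ARS Conj. 2.2 says nothing about `c_E`, and the link `c_E ↔ r_E/m_E` at
`p² ∣ N` is absent from print (refuter-2 `ref2/LIT-PLACEMENT-MANIN-ADDITIVE-v1.md` B7; Abbes–Ullmo
1996 Prop. 3.3 is stated on `Spec ℤ[1/m]`, `m²` the largest square dividing `N`). Consequences
(edges, sibling file): Manin's conjecture ∧ ARS Conj. 2.2 ⟹ this law; this law ∧ Ribet's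
`m_E ∣ r_E` (tree fact `modularDegree_dvd_congruenceNumber`) ⟹ the EFFECTIVE absolute bounds
`2·ord_p(c_E) ≤ ord_p(N)`, i.e. `ord₂(c_E) ≤ 4`, `ord₃(c_E) ≤ 2`, `ord_p(c_E) ≤ 1` (`p ≥ 5`).
BC5 WITNESS: the `c_E`-term is `≡ 0` on every table in range (Cremona, `c_E = 1` for `N ≤ 5·10⁵`;
refuter-1 trap T4), so the law is tested through its `r_E/m_E` term = ARS Conj. 2.2: print-run
falsifier «verified (Sage) for every optimal quotient of `J₀(N)`, `N ≤ 557`» (ARS 2012 p. 4) ⇒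
0 violations; TIGHT (equality) at 92B1 (`p = 2`), 99A1 (`p = 3`), 128A1 (`p = 2`, `ord₂(32/4) = 3
= ⌊7/2⌋`), 135A1 (`p = 3`) (ARS Table 1); data ask D-desc-1 = a `congruence_number` column for the
optimal curves with `4 ∣ N` or `9 ∣ N`, `N ≤ 2000`. «Why novel»: one sentence above. Beyond-print
theorem: NO (a conjecture). Refuter verdicts: REF1 **SURVIVES** (2026-08-27T13:19Z,
HOME/REFUTER-ref1.md §R1.2: rc 0; IN PRINT at `v_p(N) ≤ 1` (Abbes–Ullmo / Mazur / Česnavičius 2018 +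
ARS Thm. 2.1), a CONJECTURE at `p² ∣ N` (= ARS 2.2 ⊕ the `c`-term); `c`-term data-invisible, the
`r_E` column D-desc-1 decides; lattice clause ⇔ min-degree clause redundant under each other
(kept to match the binder shapes of `ManinConstantOne` and `AgasheRibetStein2012_conjecture`);
BC7 CLEAN); REF2 pre-placement: `c_E ↔ r_E/m_E` at `p² ∣ N` not in print (§B7). Row E-desc-2 of
HOME/CANDIDATES.md.

RENDERING (refuter-1 traps T1–T3, T7 respected): globally minimal `W`, datum `D` at the CONDUCTOR
level `N = W.conductorNorm ℤ`, the lattice clause `Λ_W = c·Λ_f` (`φ_D` optimal, `|D.c| = c_E`)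
AND the minimal-degree clause of `AgasheRibetStein2012_conjecture` /
`modularDegree_dvd_congruenceNumber` (`D.deg = m_E`: minimal among all data at level `N` with the
same newform), so that `congruenceNumber D.f = r_E` and `D.modularDegree = m_E`; the inequality is
cleared of denominators and of natural-number subtraction:
`2·(ord_p c + ord_p r_E) ≤ 2·ord_p m_E + ord_p N`.
-/

noncomputable section

open scoped MatrixGroups ModularForm

open CongruenceSubgroup WeierstrassCurve
  Literature.NumberTheory.EllipticCurves.ModularForms

namespace Summit.BirchSwinnertonDyer.Rank1Residual.ManinAdditive

/-- **Candidate E-desc-2 `ManinCongruenceDefectLaw` (cell bsd-f2-manin; a CONJECTURE, NOT in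
print, nothing asserted):** for every globally minimal elliptic `W/ℚ` with conductor
`N = W.conductorNorm ℤ`, every `X₀(N)`-parametrisation datum `D` of `W` at level `N` satisfying the
lattice clause (`φ_D` optimal) and of minimal degree among all data at level `N` with the same
newform (`D.deg = m_E`), and every prime `p`:
`2·(ord_p(D.c) + ord_p(r_{D.f})) ≤ 2·ord_p(D.deg) + ord_p(N)` — i.e.
`ord_p(c_E) + ord_p(r_E/m_E) ≤ ⌊ord_p(N)/2⌋`. Agashe–Ribet–Stein 2012 Conj. 2.2 is the same
inequality without the `ord_p(c_E)` term (tree `AgasheRibetStein2012_conjecture`).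
[cite: AgasheRibetStein2012, Conj. 2.2 (shape only: the printed conjecture bounds ord_p(r_E/m_E) alone; the law adding ord_p(c_E) is NOT in print — cell bsd-f2-manin MEMO-desc.md §3)] -/
@[conjecture] def ManinCongruenceDefectLaw : Prop :=
  ∀ (W : WeierstrassCurve ℚ) [W.IsElliptic] [W.IsGloballyMinimal] [NeZero (W.conductorNorm ℤ)]
    (D : ModularParametrizationData W (W.conductorNorm ℤ)),
    (∀ z ∈ D.L.lattice, ∃ w ∈ periodLattice D.f, z = D.c * w) →
    (∀ (W' : WeierstrassCurve ℚ) [W'.IsElliptic]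
        (D' : ModularParametrizationData W' (W.conductorNorm ℤ)),
        D'.f = D.f → D.modularDegree ≤ D'.modularDegree) →
    ∀ p : ℕ, p.Prime →
      2 * (padicValInt p D.maninConstant + padicValNat p (congruenceNumber D.f)) ≤
        2 * padicValNat p D.modularDegree + padicValNat p (W.conductorNorm ℤ)

end Summit.BirchSwinnertonDyer.Rank1Residual.ManinAdditive

end
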